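import Summits.HodgeConjecture.HodgeConjecture.Theorems.F0P3cStCharTSShellTracePSH   -- ★ p849597 LH10-p02 (g2) F1-H `smoothTrace_cmPrincipalSeriesH_indicator_shell_eq_ite`
import Literature.NumberTheory.Automorphic.CMBorelWeylTorusConjugateTwo               -- ★ p849360 LH5-p05 (g2) W2-a: `ʷt`, `torusCharPair_cm_weylConj_two`, `glDiagonal_rev_eq_weylConj_two`
import HarnessLib

/-!
# F0 · P3c · line LH6 «StCharTS» — road (D) «DEEP-FL», brick «hF1H-ADAPTER»: F1-H (★ p849597) + the rank-one Jacquet filtration (W2-c, BY SHAPE) ⟹ the spectral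
# hypothesis `hF1H` of D3-ii-H (★ p849562 ∕ ★ p849681) for the `H`-shell indicator `𝟙_{K_H (b, z₁) K_H}`, for EVERY continuous character of `T₂`

Cell `pub/hodgecm-mathlib`, crux H413 = `stmt-HodgeConjecture-24833` (`--supports` lane, helper), route HCCMUnconditional; seat LH7-p04 (g2), dealt by the road-(D) owner LH6-p03 (g0)
2026-09-02T06:06:32Z (ruling (2) «hF1H-ADAPTER★»; ROAD-D STATUS v5 `F0/P3b/LH6-p03/g0/ROAD-D.status.v5.txt` a06e459eb0272f5d, (c₄)-H).  THEOREMS ONLY (★-only imports; no definition ∕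
instance ∕ notation ∕ named fact ∕ `sorry`).  HONEST LABEL: road-(D) glue, count-neutral — nothing here closes (S-X) `stub_StXIGSt`; the Jacquet filtration of `i₂(χ)` on `U(Φ₂)_v` is a
HYPOTHESIS BY SHAPE (`hW2c`, LH5-p05 (g2)'s W2-c `u2PrincipalSeries_jacquetFiltration`, in flight) and so is the Weyl-stability of the torus level (`hKw`); HC_CM is proved only modulo the
7 printed citations (2 remaining: hLiu418 = stmt-HodgeConjecture-24832, h413 = stmt-HodgeConjecture-24833) until rung 0 closes.

THE MATHEMATICS ([Rogawski1990, §12.1 pp. 171–172, §12.7 p. 195]; [Casselman1995, §3, §6.3]; [BernsteinZelevinsky1977, §2]).  (§1) The diagonal torus of `U(σ, Φ₂)(R)` is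
`T₂ = {diag(α, (σα)⁻¹)} ≅ Rˣ` (torus relation `σ(d₀) d₁ = 1`, ★ `torus_relations_two`), so EVERY character `θ` of `T₂` is the pair character `(χ₁, 1)` with `χ₁ := θ ∘ (α ↦ diag(α, (σα)⁻¹))`
(★ `torusCharPair … 0 χ₁ 1`), and `χ₁` is continuous when `θ` and `σ` are (★ `continuous_glDiagonal`) — the rank-one twin of ★ `exists_torusCharPair_eq`, with continuity.  (§2) For such
`χ₂ = (χ₁′, 1)` the W2-c datum (`dim r_{B₂} i₂(χ₂) = 2`, a `T₂`-line of character `wχ₂ = weylTorusCharPair 0 χ₁′ 1`, quotient character `χ₂`) feeds ★ F1-H; its `hiff`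
(`χ₂|_{K_{2,n}∩T₂} = 1 ↔ wχ₂|_{K_{2,n}∩T₂} = 1`) holds because `wχ₂(k) = χ₂(ʷk)` (★ `torusCharPair_cm_weylConj_two`), `ʷ(ʷk) = k` (★ `glDiagonal_rev_eq_weylConj_two` twice) and the torus level
is `ʷ`-stable (`hKw`); finally `wχ₂(b) = χ₂(ʷb)` puts the F1-H value in the two-coset shape `A · χ₁(z₁) · (χ₂(b) + 1 · χ₂(ʷb))` of ★ p849562's `hF1H`, with
`A = ν₂(K_{2,n}) · #R₂ · ν₁(K₁) · δ_{B₂}^{1∕2}(b)` and the level `C₂ = (K_{2,n}).comap (T₂ ↪ U(Φ₂)_v)`.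

* §1 `exists_continuous_torusCharPair_eq_two` — every continuous character of the rank-one diagonal torus is a continuous pair character `(χ₁, 1)`.
* §2 **`smoothTrace_cmPrincipalSeriesH_indicator_shell_eq_hF1H`** — the `hF1H` binder of ★ `normalizedOrbitalIntegralH_eq_twoCoset` ∕ ★ `classOrbitalIntegralH_eq_twoCoset_of_spectral` for
  `fH = 𝟙_{K_H (b,z₁) K_H}`, `νH = ν₂ ⊗ ν₁`, from `hW2c` + `hKw`.

## References
* [Rogawski1990] J. D. Rogawski, *Automorphic Representations of Unitary Groups in Three Variables*, Ann. of Math. Stud. 123 (1990), §12.1 pp. 171–172; §12.7 p. 195.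
* [Casselman1995] W. Casselman, *Introduction to the theory of admissible representations of p-adic reductive groups* (1995 notes), §3, §6.3.
* [BernsteinZelevinsky1977] I. N. Bernstein, A. V. Zelevinsky, *Induced representations of reductive p-adic groups I*, Ann. Sci. ÉNS 10 (1977), §2.
-/

set_option autoImplicit false
-- the mandated namespace has the single-problem summit's repeated segment (`HodgeConjecture.HodgeConjecture`)
set_option linter.dupNamespace false

noncomputable section

open NumberField IsDedekindDomain MeasureTheory Topology
open scoped Matrix MatrixGroups Pointwise
open Literature.NumberTheory Literature.NumberTheory.Automorphic Literature.NumberTheory.Automorphic.UnitaryGroup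
open Literature.NumberTheory.Automorphic.UnitaryGroup.LineRing
open Literature.NumberTheory.Rogawski1990
open Summit.HodgeConjecture.HodgeConjecture.Cruxes.H413.F0P3cStCharTSShellTracePSH

namespace Summit.HodgeConjecture.HodgeConjecture.Cruxes.H413.F0P3cStCharTSHF1HAdapter

/-! ## §1 Every continuous character of the rank-one diagonal torus is a continuous pair character -/

section RankOneTorus

variable {R : Type*} [CommRing R] [TopologicalSpace R] [IsTopologicalRing R] (σ : R →+* R)

/-- **Every continuous character of the diagonal torus `T₂` of `U(σ, Φ₂)(R)` is a continuous pair character `(χ₁, 1)`** (`σ` a continuous involution): for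
`θ : T₂ →* ℂˣ` put `χ₁(α) := θ(diag(α, (σα)⁻¹))`; since every `t = diag(d₀, d₁) ∈ T₂` has `d₁ = (σ d₀)⁻¹` (★ `torus_relations_two`), `θ(t) = χ₁(t₀₀) = torusCharPair σ Φ₂ _ 0 χ₁ 1 t`,
and `χ₁` is continuous (★ `continuous_glDiagonal`).  The rank-one twin of ★ `exists_torusCharPair_eq` («`χ = (χ₁, χ₂)`», [Rogawski1990, §12.1 p. 171]), with continuity.
[cite: Rogawski1990, §12.1 p. 171] -/
theorem exists_continuous_torusCharPair_eq_two (hσ : ∀ x : R, σ (σ x) = x) (hσc : Continuous σ) {J : Matrix (Fin 2) (Fin 2) R}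
    (hJ : J = (StdForm.antidiagonal 2).over R) (θ : ↥(torusU σ J) →* ℂˣ) (hθ : Continuous fun t => ((θ t : ℂˣ) : ℂ)) :
    ∃ χ₁ : Rˣ →* ℂˣ, Continuous (fun x => ((χ₁ x : ℂˣ) : ℂ)) ∧ torusCharPair σ J hJ 0 χ₁ 1 = θ := by
  subst hJ
  have hσu : ∀ u : Rˣ, Units.map (σ : R →* R) (Units.map (σ : R →* R) u) = u := fun u => Units.ext (hσ u)
  have hσv : ∀ u : Rˣ, σ (u : R) = ((Units.map (σ : R →* R) u : Rˣ) : R) := fun u => rfl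
  -- the section `α ↦ diag(α, (σα)⁻¹)` as a homomorphism `Rˣ →* T₂`
  let d₁ : Rˣ → Fin 2 → Rˣ := fun α => ![α, (Units.map (σ : R →* R) α)⁻¹]
  have hd₁ : ∀ α, glDiagonal 2 R (d₁ α) ∈ unitaryGroupOfForm σ ((StdForm.antidiagonal 2).over R) := by
    intro α
    rw [glDiagonal_mem_unitaryGroupOfForm_antidiagonal_iff]
    intro i
    fin_cases i
    · show σ (((Units.map (σ : R →* R) α)⁻¹ : Rˣ) : R) * (α : R) = 1
      rw [hσv, map_inv, hσu, Units.inv_mul]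
    · show σ ((α : Rˣ) : R) * (((Units.map (σ : R →* R) α)⁻¹ : Rˣ) : R) = 1
      rw [hσv, Units.mul_inv]
  have hd₁one : d₁ 1 = 1 := by
    funext k
    fin_cases k
    · rfl
    · show (Units.map (σ : R →* R) 1)⁻¹ = 1
      rw [map_one, inv_one]
  have hd₁mul : ∀ α β, d₁ (α * β) = d₁ α * d₁ β := by
    intro α β
    funext k
    fin_cases k
    · rfl
    · show (Units.map (σ : R →* R) (α * β))⁻¹ = (Units.map (σ : R →* R) α)⁻¹ * (Units.map (σ : R →* R) β)⁻¹
      rw [map_mul, mul_inv]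
  let s : Rˣ →* ↥(torusU σ ((StdForm.antidiagonal 2).over R)) :=
    { toFun := fun α => ⟨⟨glDiagonal 2 R (d₁ α), hd₁ α⟩, ⟨d₁ α, rfl⟩⟩
      map_one' := Subtype.ext (Subtype.ext (by
        show glDiagonal 2 R (d₁ 1) = 1
        rw [hd₁one, map_one]))
      map_mul' := fun α β => Subtype.ext (Subtype.ext (by
        show glDiagonal 2 R (d₁ (α * β)) = glDiagonal 2 R (d₁ α) * glDiagonal 2 R (d₁ β)
        rw [hd₁mul, map_mul])) }
  have hs : Continuous (s : Rˣ → ↥(torusU σ ((StdForm.antidiagonal 2).over R))) := by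
    have hdiag : Continuous fun α : Rˣ => glDiagonal 2 R (d₁ α) := by
      refine (continuous_glDiagonal (n := 2) R).comp (continuous_pi fun i => ?_)
      fin_cases i
      · exact continuous_id
      · exact (Continuous.units_map (σ : R →* R) hσc).inv
    exact (hdiag.subtype_mk _).subtype_mk _
  -- `s (t₀₀) = t` for every `t ∈ T₂`
  have hst : ∀ t : ↥(torusU σ ((StdForm.antidiagonal 2).over R)), s (torusEntry σ ((StdForm.antidiagonal 2).over R) 0 t) = t := by
    intro t
    obtain ⟨d, hd⟩ := (mem_torusU_iff _).1 t.2
    obtain ⟨-, h01⟩ := torus_relations_two σ rfl t hd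
    rw [torusEntry_eq_of_glDiagonal_eq σ _ 0 t d hd]
    apply Subtype.ext
    apply Subtype.ext
    show glDiagonal 2 R (d₁ (d 0)) = ((t : ↥(unitaryGroupOfForm σ ((StdForm.antidiagonal 2).over R))) : GL (Fin 2) R)
    rw [← hd]
    congr 1
    funext k
    fin_cases k
    · rfl
    · show (Units.map (σ : R →* R) (d 0))⁻¹ = d 1
      exact inv_eq_of_mul_eq_one_right (Units.ext h01)
  refine ⟨θ.comp s, hθ.comp hs, ?_⟩
  ext t
  rw [torusCharPair_apply, MonoidHom.one_apply, mul_one, MonoidHom.comp_apply, hst t]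

end RankOneTorus

/-! ## §2 The adapter: F1-H + W2-c ⟹ `hF1H` -/

section CM

variable (L : Type) [Field L] [NumberField L] [IsCMField L] (v : HeightOneSpectrum (𝓞 ↥(maximalRealSubfield L)))
  [MeasurableSpace ((cmDatum L 2 (Matrix.of fun i j : Fin 2 => if i.val + j.val + 1 = 2 then (1 : L) else 0)).Local v)] [BorelSpace ((cmDatum L 2 (Matrix.of fun i j : Fin 2 => if i.val + j.val + 1 = 2 then (1 : L) else 0)).Local v)] [MeasurableSpace ((cmDatum L 1 (Matrix.of fun i j : Fin 1 => if i.val + j.val + 1 = 1 then (1 : L) else 0)).Local v)] [BorelSpace ((cmDatum L 1 (Matrix.of fun i j : Fin 1 => if i.val + j.val + 1 = 1 then (1 : L) else 0)).Local v)]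

open scoped Classical in
set_option maxHeartbeats 4000000 in
set_option synthInstance.maxHeartbeats 400000 in
/-- **«hF1H-ADAPTER».**  At a finite place `v` of `L⁺`, with Haar measures `ν₂` on `U(Φ₂)_v`, `ν₁` on `U(Φ₁)_v`, an Iwahori datum `𝓘₂` of `B₂`, a level `n`, a torus element `b` dominant at
level `n`, a left transversal `R₂` of `K_{2,n} ∕ (K_{2,n} ∩ bK_{2,n}b⁻¹)`, a compact open `K₁ ≤ U(Φ₁)_v`, `z₁ ∈ U(Φ₁)_v` (the frame of ★ F1-H p849597 VERBATIM), a Weyl representative `w₀`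
(matrix `Φ₂`, ★ W2-a) NORMALISING the torus level (`hKw`), and the rank-one Jacquet filtration of `i₂(χ)` for every continuous pair character `χ = (χ₁, χ₂)` BY SHAPE (`hW2c` = LH5-p05's
W2-c head): for EVERY continuous character `χ₂` of `T₂` and every open-kernel character `χ₁` of `U(Φ₁)_v`,
`tr i_H(χ₂ ⊠ χ₁)(𝟙_{K_H (b,z₁) K_H}; ν₂ ⊗ ν₁) = if χ₂|_{C₂} = 1 ∧ χ₁|_{K₁} = 1 then A · χ₁(z₁) · (χ₂(b) + 1 · χ₂(ʷb)) else 0`,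
`K_H = K_{2,n} × K₁`, `C₂ = K_{2,n}.comap (T₂ ↪ U(Φ₂)_v)`, `A = ν₂(K_{2,n}) · #R₂ · ν₁(K₁) · δ_{B₂}^{1∕2}(b)`, `ʷb = w₀ b w₀⁻¹` — the `hF1H` binder of ★ p849562 ∕ ★ p849681 with
`b₁ := b`, `b₂ := ʷb`, `κ := 1`. [cite: Rogawski1990, §12.1 pp. 171–172; §12.7 p. 195] [cite: Casselman1995, §3, §6.3] [cite: BernsteinZelevinsky1977, §2] -/
theorem smoothTrace_cmPrincipalSeriesH_indicator_shell_eq_hF1H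
    (ν₂ : Measure ((cmDatum L 2 (Matrix.of fun i j : Fin 2 => if i.val + j.val + 1 = 2 then (1 : L) else 0)).Local v)) [ν₂.IsHaarMeasure] (ν₁ : Measure ((cmDatum L 1 (Matrix.of fun i j : Fin 1 => if i.val + j.val + 1 = 1 then (1 : L) else 0)).Local v)) [ν₁.IsHaarMeasure]
    (𝓘₂ : (cmBorelTriple L 2 v).IwahoriDatum) (n : ℕ)
    {b : ↥(unitaryGroupOfForm (conjLocal L (IsCMField.complexConj L) v) (cmLocalForm L 2 v))} (hbM : b ∈ (cmBorelTriple L 2 v).M)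
    (hbN : ∀ x ∈ 𝓘₂.K n ⊓ (cmBorelTriple L 2 v).N, b * x * b⁻¹ ∈ 𝓘₂.K n)
    (hbNbar : ∀ x ∈ 𝓘₂.K n ⊓ 𝓘₂.Nbar, b⁻¹ * x * b ∈ 𝓘₂.K n ⊓ 𝓘₂.Nbar)
    (hbexh : ∀ x ∈ (cmBorelTriple L 2 v).N, ∃ m : ℕ, ∀ m', m ≤ m' → b ^ m' * x * (b ^ m')⁻¹ ∈ 𝓘₂.K n)
    {R₂ : Finset ↥(unitaryGroupOfForm (conjLocal L (IsCMField.complexConj L) v) (cmLocalForm L 2 v))} (hR₂ : IsLeftTransversal (𝓘₂.K n) (𝓘₂.K n ⊓ ConjAct.toConjAct b • 𝓘₂.K n) R₂)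
    (K₁ : Subgroup ((cmDatum L 1 (Matrix.of fun i j : Fin 1 => if i.val + j.val + 1 = 1 then (1 : L) else 0)).Local v)) (hK₁o : IsOpen (K₁ : Set ((cmDatum L 1 (Matrix.of fun i j : Fin 1 => if i.val + j.val + 1 = 1 then (1 : L) else 0)).Local v))) (hK₁c : IsCompact (K₁ : Set ((cmDatum L 1 (Matrix.of fun i j : Fin 1 => if i.val + j.val + 1 = 1 then (1 : L) else 0)).Local v))) (z₁ : ((cmDatum L 1 (Matrix.of fun i j : Fin 1 => if i.val + j.val + 1 = 1 then (1 : L) else 0)).Local v))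
    (w₀ : ↥(unitaryGroupOfForm (conjLocal L (IsCMField.complexConj L) v) (cmLocalForm L 2 v))) (hw₀ : Units.val (w₀ : GL (Fin 2) (LocalRing L v)) = cmLocalForm L 2 v)
    (hKw : ∀ k : ↥(cmBorelTriple L 2 v).M, (k : ↥(unitaryGroupOfForm (conjLocal L (IsCMField.complexConj L) v) (cmLocalForm L 2 v))) ∈ 𝓘₂.K n → w₀ * (k : ↥(unitaryGroupOfForm (conjLocal L (IsCMField.complexConj L) v) (cmLocalForm L 2 v))) * w₀⁻¹ ∈ 𝓘₂.K n)
    (hW2c : haveI := locallyCompactSpace_cmBorelU L 2 v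
      ∀ (χ₁ : (LocalRing L v)ˣ →* ℂˣ) (χ₂ : ↥(normOneUnits (conjLocal L (IsCMField.complexConj L) v)) →* ℂˣ),
        Continuous (fun x => ((χ₁ x : ℂˣ) : ℂ)) → Continuous (fun x => ((χ₂ x : ℂˣ) : ℂ)) →
        FiniteDimensional ℂ ((cmBorelTriple L 2 v).restrict (cmPrincipalSeries L 2 v
            (torusCharPair (conjLocal L (IsCMField.complexConj L) v) (cmLocalForm L 2 v) (cmLocalForm_eq_over L 2 v) 0 χ₁ χ₂))).Coinvariants ∧
        Module.finrank ℂ ((cmBorelTriple L 2 v).restrict (cmPrincipalSeries L 2 v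
            (torusCharPair (conjLocal L (IsCMField.complexConj L) v) (cmLocalForm L 2 v) (cmLocalForm_eq_over L 2 v) 0 χ₁ χ₂))).Coinvariants = 2 ∧
        ∃ ℓ : Submodule ℂ ((cmBorelTriple L 2 v).restrict (cmPrincipalSeries L 2 v
            (torusCharPair (conjLocal L (IsCMField.complexConj L) v) (cmLocalForm L 2 v) (cmLocalForm_eq_over L 2 v) 0 χ₁ χ₂))).Coinvariants,
          Module.finrank ℂ ↥ℓ = 1 ∧
          (∀ (m : ↥(cmBorelTriple L 2 v).M), ∀ x ∈ ℓ,
            (cmPrincipalSeries L 2 v (torusCharPair (conjLocal L (IsCMField.complexConj L) v) (cmLocalForm L 2 v) (cmLocalForm_eq_over L 2 v) 0 χ₁ χ₂)).normalizedJacquet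
                (cmBorelTriple L 2 v) m x =
              ((weylTorusCharPair (conjLocal L (IsCMField.complexConj L) v) (cmLocalForm L 2 v) (cmLocalForm_eq_over L 2 v) 0 χ₁ χ₂ m : ℂˣ) : ℂ) • x) ∧
          (∀ (m : ↥(cmBorelTriple L 2 v).M) (x : ((cmBorelTriple L 2 v).restrict (cmPrincipalSeries L 2 v
              (torusCharPair (conjLocal L (IsCMField.complexConj L) v) (cmLocalForm L 2 v) (cmLocalForm_eq_over L 2 v) 0 χ₁ χ₂))).Coinvariants),
            (cmPrincipalSeries L 2 v (torusCharPair (conjLocal L (IsCMField.complexConj L) v) (cmLocalForm L 2 v) (cmLocalForm_eq_over L 2 v) 0 χ₁ χ₂)).normalizedJacquet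
                (cmBorelTriple L 2 v) m x -
              ((torusCharPair (conjLocal L (IsCMField.complexConj L) v) (cmLocalForm L 2 v) (cmLocalForm_eq_over L 2 v) 0 χ₁ χ₂ m : ℂˣ) : ℂ) • x ∈ ℓ)) :
    haveI := locallyCompactSpace_cmBorelU L 2 v
    ∀ (χ₂ : ↥(torusU (conjLocal L (IsCMField.complexConj L) v) (cmLocalForm L 2 v)) →* ℂˣ) (_hχ₂ : Continuous fun t => ((χ₂ t : ℂˣ) : ℂ))
      (χ₁ : ((cmDatum L 1 (Matrix.of fun i j : Fin 1 => if i.val + j.val + 1 = 1 then (1 : L) else 0)).Local v) →* ℂˣ) (_hχ₁ : IsOpen ((χ₁.ker : Subgroup ((cmDatum L 1 (Matrix.of fun i j : Fin 1 => if i.val + j.val + 1 = 1 then (1 : L) else 0)).Local v)) : Set ((cmDatum L 1 (Matrix.of fun i j : Fin 1 => if i.val + j.val + 1 = 1 then (1 : L) else 0)).Local v))),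
      (cmPrincipalSeriesH L v χ₂ χ₁).smoothTrace (ν₂.prod ν₁)
          ((DoubleCoset.doubleCoset ((b, z₁) : ↥(unitaryGroupOfForm (conjLocal L (IsCMField.complexConj L) v) (cmLocalForm L 2 v)) × ((cmDatum L 1 (Matrix.of fun i j : Fin 1 => if i.val + j.val + 1 = 1 then (1 : L) else 0)).Local v))
              (((𝓘₂.K n).prod K₁ : Subgroup (↥(unitaryGroupOfForm (conjLocal L (IsCMField.complexConj L) v) (cmLocalForm L 2 v)) × ((cmDatum L 1 (Matrix.of fun i j : Fin 1 => if i.val + j.val + 1 = 1 then (1 : L) else 0)).Local v))) : Set (↥(unitaryGroupOfForm (conjLocal L (IsCMField.complexConj L) v) (cmLocalForm L 2 v)) × ((cmDatum L 1 (Matrix.of fun i j : Fin 1 => if i.val + j.val + 1 = 1 then (1 : L) else 0)).Local v)))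
              (((𝓘₂.K n).prod K₁ : Subgroup (↥(unitaryGroupOfForm (conjLocal L (IsCMField.complexConj L) v) (cmLocalForm L 2 v)) × ((cmDatum L 1 (Matrix.of fun i j : Fin 1 => if i.val + j.val + 1 = 1 then (1 : L) else 0)).Local v))) : Set (↥(unitaryGroupOfForm (conjLocal L (IsCMField.complexConj L) v) (cmLocalForm L 2 v)) × ((cmDatum L 1 (Matrix.of fun i j : Fin 1 => if i.val + j.val + 1 = 1 then (1 : L) else 0)).Local v)))).indicator fun _ => (1 : ℂ)) =
        if (∀ c ∈ (𝓘₂.K n).comap (cmBorelTriple L 2 v).M.subtype, χ₂ c = 1) ∧ (∀ k ∈ K₁, χ₁ k = 1)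
        then ((ν₂.real (𝓘₂.K n : Set ↥(unitaryGroupOfForm (conjLocal L (IsCMField.complexConj L) v) (cmLocalForm L 2 v))) : ℂ) * (R₂.card : ℂ) * (ν₁.real (K₁ : Set ((cmDatum L 1 (Matrix.of fun i j : Fin 1 => if i.val + j.val + 1 = 1 then (1 : L) else 0)).Local v)) : ℂ) *
              (((rootDeltaChar (cmBorelTriple L 2 v).P (Subgroup.inclusion (cmBorelTriple L 2 v).M_le ⟨b, hbM⟩)) : ℂˣ) : ℂ)) *
            ((χ₁ z₁ : ℂˣ) : ℂ) *
          (((χ₂ ⟨b, hbM⟩ : ℂˣ) : ℂ) + 1 * ((χ₂ ⟨w₀ * b * w₀⁻¹, weylConj_mem_cmTorus_two L v w₀ hw₀ ⟨b, hbM⟩⟩ : ℂˣ) : ℂ))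
        else 0 := by
  intro χ₂ hχ₂ χ₁ hχ₁
  haveI := locallyCompactSpace_cmBorelU L 2 v
  -- §1: `χ₂` is a continuous pair character `(χ₁′, 1)`
  obtain ⟨χ₁', hχ₁'c, hχeq⟩ := exists_continuous_torusCharPair_eq_two (conjLocal L (IsCMField.complexConj L) v) (conjLocal_conjLocal_cm L v)
    (continuous_conjLocal L (IsCMField.complexConj L) v) (cmLocalForm_eq_over L 2 v) χ₂ hχ₂
  subst hχeq
  -- the W2-c datum for `(χ₁′, 1)`; `χa := wχ₂`
  obtain ⟨hfd, h2, ℓ, hℓ1, hL, hQ⟩ := hW2c χ₁' 1 hχ₁'c (by simpa only [MonoidHom.one_apply, Units.val_one] using continuous_const)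
  -- `ʷ(ʷk) = k` on `T₂`
  have hww : ∀ k : ↥(cmBorelTriple L 2 v).M,
      (⟨w₀ * ((⟨w₀ * (k : ↥(unitaryGroupOfForm (conjLocal L (IsCMField.complexConj L) v) (cmLocalForm L 2 v))) * w₀⁻¹, weylConj_mem_cmTorus_two L v w₀ hw₀ k⟩ : ↥(cmBorelTriple L 2 v).M) : ↥(unitaryGroupOfForm (conjLocal L (IsCMField.complexConj L) v) (cmLocalForm L 2 v))) * w₀⁻¹,
        weylConj_mem_cmTorus_two L v w₀ hw₀ ⟨w₀ * (k : ↥(unitaryGroupOfForm (conjLocal L (IsCMField.complexConj L) v) (cmLocalForm L 2 v))) * w₀⁻¹, weylConj_mem_cmTorus_two L v w₀ hw₀ k⟩⟩ : ↥(cmBorelTriple L 2 v).M) = k := by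
    intro k
    have hk2 : ∃ d : Fin 2 → (LocalRing L v)ˣ, glDiagonal 2 (LocalRing L v) d = ((k : ↥(unitaryGroupOfForm (conjLocal L (IsCMField.complexConj L) v) (cmLocalForm L 2 v))) : GL (Fin 2) (LocalRing L v)) := k.2
    obtain ⟨d, hd⟩ := hk2
    have h1 := glDiagonal_rev_eq_weylConj_two (conjLocal L (IsCMField.complexConj L) v) (cmLocalForm_eq_over L 2 v) w₀ hw₀ k hd
    have h2 := glDiagonal_rev_eq_weylConj_two (conjLocal L (IsCMField.complexConj L) v) (cmLocalForm_eq_over L 2 v) w₀ hw₀ _ h1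
    apply Subtype.ext
    apply Subtype.ext
    rw [← h2, ← hd]
    congr 1
    funext i
    simp only [Fin.rev_rev]
  -- `hiff` from the Weyl-stability of the torus level
  have hiff : (∀ k : ↥(cmBorelTriple L 2 v).M, (k : ↥(unitaryGroupOfForm (conjLocal L (IsCMField.complexConj L) v) (cmLocalForm L 2 v))) ∈ 𝓘₂.K n →
        torusCharPair (conjLocal L (IsCMField.complexConj L) v) (cmLocalForm L 2 v) (cmLocalForm_eq_over L 2 v) 0 χ₁' 1 k = 1) ↔
      (∀ k : ↥(cmBorelTriple L 2 v).M, (k : ↥(unitaryGroupOfForm (conjLocal L (IsCMField.complexConj L) v) (cmLocalForm L 2 v))) ∈ 𝓘₂.K n →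
        weylTorusCharPair (conjLocal L (IsCMField.complexConj L) v) (cmLocalForm L 2 v) (cmLocalForm_eq_over L 2 v) 0 χ₁' 1 k = 1) := by
    constructor
    · intro h k hk
      rw [← torusCharPair_cm_weylConj_two L v w₀ hw₀ χ₁' 1 k]
      exact h ⟨w₀ * (k : ↥(unitaryGroupOfForm (conjLocal L (IsCMField.complexConj L) v) (cmLocalForm L 2 v))) * w₀⁻¹, weylConj_mem_cmTorus_two L v w₀ hw₀ k⟩ (hKw k hk)
    · intro h k hk
      have hk' : ((⟨w₀ * (k : ↥(unitaryGroupOfForm (conjLocal L (IsCMField.complexConj L) v) (cmLocalForm L 2 v))) * w₀⁻¹, weylConj_mem_cmTorus_two L v w₀ hw₀ k⟩ : ↥(cmBorelTriple L 2 v).M) : ↥(unitaryGroupOfForm (conjLocal L (IsCMField.complexConj L) v) (cmLocalForm L 2 v))) ∈ 𝓘₂.K n := hKw k hk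
      have := h ⟨w₀ * (k : ↥(unitaryGroupOfForm (conjLocal L (IsCMField.complexConj L) v) (cmLocalForm L 2 v))) * w₀⁻¹, weylConj_mem_cmTorus_two L v w₀ hw₀ k⟩ hk'
      rwa [← torusCharPair_cm_weylConj_two L v w₀ hw₀ χ₁' 1, hww k] at this
  -- ★ F1-H
  rw [smoothTrace_cmPrincipalSeriesH_indicator_shell_eq_ite L v ν₂ ν₁ _ χ₁ hχ₁ 𝓘₂ n hbM hbN hbNbar hbexh hR₂ K₁ hK₁o hK₁c z₁ hfd h2 ℓ hℓ1 _ hL hQ hiff]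
  -- compare the two closed forms
  have hwb : weylTorusCharPair (conjLocal L (IsCMField.complexConj L) v) (cmLocalForm L 2 v) (cmLocalForm_eq_over L 2 v) 0 χ₁' 1 ⟨b, hbM⟩ =
      torusCharPair (conjLocal L (IsCMField.complexConj L) v) (cmLocalForm L 2 v) (cmLocalForm_eq_over L 2 v) 0 χ₁' 1
        ⟨w₀ * b * w₀⁻¹, weylConj_mem_cmTorus_two L v w₀ hw₀ ⟨b, hbM⟩⟩ :=
    (torusCharPair_cm_weylConj_two L v w₀ hw₀ χ₁' 1 ⟨b, hbM⟩).symm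
  have hC : (∀ c ∈ (𝓘₂.K n).comap (cmBorelTriple L 2 v).M.subtype,
        torusCharPair (conjLocal L (IsCMField.complexConj L) v) (cmLocalForm L 2 v) (cmLocalForm_eq_over L 2 v) 0 χ₁' 1 c = 1) ↔
      (∀ k : ↥(cmBorelTriple L 2 v).M, (k : ↥(unitaryGroupOfForm (conjLocal L (IsCMField.complexConj L) v) (cmLocalForm L 2 v))) ∈ 𝓘₂.K n →
        torusCharPair (conjLocal L (IsCMField.complexConj L) v) (cmLocalForm L 2 v) (cmLocalForm_eq_over L 2 v) 0 χ₁' 1 k = 1) := by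
    simp only [Subgroup.mem_comap, Subgroup.coe_subtype]
  by_cases hP : (∀ k : ↥(cmBorelTriple L 2 v).M, (k : ↥(unitaryGroupOfForm (conjLocal L (IsCMField.complexConj L) v) (cmLocalForm L 2 v))) ∈ 𝓘₂.K n →
      torusCharPair (conjLocal L (IsCMField.complexConj L) v) (cmLocalForm L 2 v) (cmLocalForm_eq_over L 2 v) 0 χ₁' 1 k = 1) ∧ (∀ k ∈ K₁, χ₁ k = 1)
  · rw [if_pos hP, if_pos (by rwa [hC]), hwb]
    ring
  · rw [if_neg hP, if_neg (by rwa [hC]), mul_zero]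

end CM

end Summit.HodgeConjecture.HodgeConjecture.Cruxes.H413.F0P3cStCharTSHF1HAdapter

end
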